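import Literature.AnabelianGeometry.EtaleTheta.Discharge.Sec1Prop18ConjEpsPMModelTate
import Literature.AnabelianGeometry.EtaleTheta.SettingModelTateInvClauses
import Literature.AnabelianGeometry.EtaleTheta.Discharge.Sec1Thm110MatchingOfDeck
import Literature.AnabelianGeometry.EtaleTheta.Discharge.Sec1Thm110iiOfDecompTransport
import HarnessLib

/-!
# [EtTh] Thm. 1.10 (i)(ii) — and (i)-uniqueness — at the STAGE-2 («Tate shear») model FOR A NON-TRIVIAL ISOMORPHISM:
# `γ :=` the automorphism of `Π^tp_Ċ` induced by `ε_±` (`Γ = conj ε_±`, `γ_X = ι` the cocycle-corrected inversion),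
# with Prop. 1.5 (iii) inhabited — the K2 deck route with EVERY binder discharged at `MuTwoSetting.modelχq p 1 2`

S. Mochizuki, *The étale theta function and its Frobenioid-theoretic manifestations*, Publ. RIMS **45** (2009) [EtTh],
§1: Prop. 1.8 p. 28 ("the isomorphism `Π^tp_{Xα} →̃ Π^tp_{Xβ}` induced by γ"), Def. 1.9 p. 29, Thm. 1.10 (i)(ii) pp. 29–30
("for [an arbitrary] isomorphism `γ : Π^tp_{Ċα} →̃ Π^tp_{Ċβ}`"; proof of (ii): «[the decomposition group of points of
`Ÿβ` lying over] `τ^{±1}`»); §2 p. 36 (the inversion `ι`) [cite: MochizukiEtTh2009, Thm 1.10 (ii) p.30]. Layer L2 of the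
abc-iut cell, seat abc-iut-w5-d171 (gen 4; R78 Kummer lineage), row «K2-NV @ STAGE 2, NON-TRIVIAL γ» part B′ — the
stage-2 twin of abc-iut-w5-d140's `Discharge/Sec1Thm110ModelChiInversionNV` (p445493). Over part A′
(`Discharge/Sec1Prop18ConjEpsPMModelTate`: `conjEpsPMχq`, `preservesCoverings_conjEpsPMχq`, `gammaDotCχq`,
`gammaDotCχq_ne_refl`), part 0 (`Discharge/Sec1Thm110ModelTateNV`, p446740: `etaleThetaDataχqInr`, `kummerDataχqInr`,
`anchoredStandardDataχq`, `epsZχq`, `modelχq_isAdmissibleEpsZ`, `exists_deck_modelχq`, `prop15ii/iii_etaleThetaDataχqInr`,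
`modelχq_thm110iUnique`, `kappaUnitχq_tate_eq`, `inl_bPowGfp_conj_sectionχq_left/right`), abc-iut-L2-d1's stage-2
inversion files (`isInversionAut_inversionχq`, `thm16i_inversionχq`, **`transport_etaDdχq`** — `ι` fixes `η̈♯` —,
**`transport_inflTheta_kumYdd_ofSection`** (p447176) — `ι` fixes the Kummer classes of constants —, `hasThetaTopology_modelχq`), abc-iut-w5-d249's `inversionχq` API
(`inversionχq_apply`, `tateInversion_left/right`, `invDefect_tatePairHom`, `gfpInv_bPowGfp`, `inversionχq_inversionχq`,
`inversionχq_ne_refl`), abc-iut-w5-d140's `exists_coboundary_kappa_mul_kappaInv` and K2 routes p430193 / p428966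
(`thm110i/ii_of_decompTransport_of_deck`, `transport_conj`), abc-iut's `thetaCompanionOfAut` — all BY NAME.

WHAT (`M := MuTwoSetting.modelχq p 1 2`, `p ≡ 1 (mod 4)` for the Def. 1.9 datum):
* `companionInvχq` (a theta companion of `ι`), **`thm110HypothesisInvχq : Thm110Hypothesis ε_Z ε_Z hC hC E E gammaDotCχq`**
  with `E := etaleThetaDataχqInr` (class `η̈♯ = etaDdχq`), `Γ := conj ε_±`, `γ_X := ι`; `maps_orbit` PROVED (the
  transport fixes `η̈♯` — abc-iut-L2-d1 — and carries `conj_σ` to `conj_{ισ}`; `ι(Π^tp_Ẋ) = Π^tp_Ẋ`);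
* **`deltaInduced_invχq : Thm110DeltaInduced H (refl)`** — `ι` fixes every inflated Kummer class of a constant at stage 2
  (abc-iut-L2-d1's `transport_inflTheta_kumYdd_ofSection`, p447176: the cocycle factors through `aug`, `aug ∘ ι = aug`,
  `ι^Θ = id` on `Δ_Θ`) («the isomorphism `K̈^× ⥲ K̈^×` induced by γ» is the identity),
  `deltaCompat_refl_invχq`;
* r5 **`decompTransport_invχq : Thm110DecompTransport H A A`** by the SECOND printed alternative «`τ ↦ τ⁻¹`»: at the Tate
  pair `(i, j) = (1, 2)` the inversion defect `b^{κ_p^{j−2i}}` VANISHES on sections, so — exactly as at stage 1 —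
  `ι(D_τ) = b^{2c₀}·D_{τ⁻¹}·b^{−2c₀}` with `c₀` the coboundary constant of `κ_{√−1}·κ_{(√−1)⁻¹}`, and `b^{2c₀} = (b^{c₀})² ∈ Π^tp_Ẍ`;
* **`modelχq_thm110i_and_ii_invχq : Thm110i H A A ∧ Thm110ii H A A`** by the deck route p430193 with EVERY binder a
  theorem, and the census headline **`MuTwoSetting.exists_stage2_model_thm110_nontrivial_iso_with_prop15iii`**: ONE
  Def. 1.7 setting with `IsEtThOrigin ∧ IsTateOrigin`, a NON-identity `γ` (`γ_X` a non-trivial involution), an étale-theta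
  datum satisfying `Prop15i ∧ Prop15ii ∧ Prop15iii`, an anchored standard datum with the deck relation, and
  `Thm110i ∧ Thm110ii ∧ Thm110iUnique` — the fullest instance form of FACT-LIST F-0512 / F-0513 / F-0514 in the cell.

HONEST FRAMING: SEMI-SYNTHETIC model (the Tate-sheared χ-twisted root; not the tempered `π₁` of a curve) — non-vacuity /
consistency evidence for the typed interface ONLY; `γ` is an inner automorphism of `Π^tp_Ċ` coming from `Π^tp_C` (print
allows arbitrary isomorphisms); the values of `η̈^Θ` at section-points are not the printed `Θ̈(√−1)`; nothing of [EtTh] is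
asserted; a FACT row is an assumption label; typed ≠ proved; no side is taken on [IUTchIII] Cor. 3.12. Definitions
(class (b) constructions over FROZEN records, no instance, no notation, no `Prop` fact): `companionInvχq` (abbrev),
`thm110HypothesisInvχq`.
-/

noncomputable section

namespace Literature.AnabelianGeometry.EtaleTheta.SettingModel

open Literature.AnabelianGeometry.SemiGraphs Literature.AnabelianGeometry.AbsoluteAnabelian
open _root_.Topology _root_.Function

variable (p : ℕ) [Fact p.Prime]

/-! ### §0. The actors -/

/-- **A theta companion `ι^Θ` of the stage-2 inversion** (abc-iut's `thetaCompanionOfAut`: `ι(Δ^tp_X) = Δ^tp_X`,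
`toTheta` a quotient map; the term of abc-iut-L2-d1's `nonempty_thetaCompanion_inversionχq`). [cite: MochizukiEtTh2009, Thm 1.6 (ii) p.24] -/
abbrev companionInvχq :
    ThetaSetting.ThetaCompanion (Dα := (ThetaSetting.modelχq p 1 2 even_two)) (Dβ := (ThetaSetting.modelχq p 1 2 even_two)) (inversionχq p 1 2) :=
  (ThetaSetting.modelχq p 1 2 even_two).thetaCompanionOfAut (inversionχq p 1 2)
    (isInversionAut_inversionχq p 1 2 even_two).map_deltaTemp (hasThetaTopology_modelχq p 1 2 even_two).isQuotientMap_toTheta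

/-! ### §2. The hypothesis of Thm. 1.10 for `γ` at the stage-2 record -/

/-- `inclX σ ∈ Π^tp_Ẋ ↔ inclX (ι σ) ∈ Π^tp_Ẋ` (`Γ(Π^tp_Ẋ) = Π^tp_Ẋ`, part A′). [cite: MochizukiEtTh2009, Prop 1.8 p.28] -/
theorem inl_inversionχq_mem_dotX_iff (σ : PiTpχq p 1 2) :
    (SemidirectProduct.inl (inversionχq p 1 2 σ) : PiTpCq p 1 2) ∈ (MuTwoSetting.modelχq p 1 2 even_two).dotX (epsZχq p) ↔
      (SemidirectProduct.inl σ : PiTpCq p 1 2) ∈ (MuTwoSetting.modelχq p 1 2 even_two).dotX (epsZχq p) := by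
  have hmap := (preservesCoverings_conjEpsPMχq p).map_dotX
  constructor
  · intro h
    have h' : conjEpsPMχq p (SemidirectProduct.inl (inversionχq p 1 2 σ)) ∈
        ((MuTwoSetting.modelχq p 1 2 even_two).dotX (epsZχq p)).map (conjEpsPMχq p).toMulEquiv.toMonoidHom := ⟨_, h, rfl⟩
    rw [hmap, conjEpsPMχq_inl, inversionχq_inversionχq] at h'
    exact h'
  · intro h
    have h' : conjEpsPMχq p (SemidirectProduct.inl σ) ∈
        ((MuTwoSetting.modelχq p 1 2 even_two).dotX (epsZχq p)).map (conjEpsPMχq p).toMulEquiv.toMonoidHom := ⟨_, h, rfl⟩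
    rwa [hmap, conjEpsPMχq_inl] at h'

/-- **The hypothesis of Thm. 1.10 HOLDS at the stage-2 record for the non-trivial `γ`** — `Ċ` of type `(1, μ₂)±`
(admissible `ε_Z := a`), `Γ := conj ε_±` preserving the coverings and restricting to `γ` up to the inner automorphism by
`c := ε_± ε_μ⁻¹ ε_±⁻¹`, the induced `γ_X = ι` with Thm. 1.6 (i) and a theta companion, and «`γ_X` maps `η̈^{Θ,Z} ↦ η̈^{Θ,Z}`»
(the transport FIXES `η̈♯`, abc-iut-L2-d1's `transport_etaDdχq`, and carries `Π^tp_Ẋ`-conjugates to `Π^tp_Ẋ`-conjugates).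
DEFINED. [cite: MochizukiEtTh2009, Thm 1.10 p.29] -/
def thm110HypothesisInvχq :
    Thm110Hypothesis (Mα := MuTwoSetting.modelχq p 1 2 even_two) (Mβ := MuTwoSetting.modelχq p 1 2 even_two)
      (epsZχq p) (epsZχq p) (ThetaSetting.modelχq p 1 2 even_two).compat (ThetaSetting.modelχq p 1 2 even_two).compat (etaleThetaDataχqInr p) (etaleThetaDataχqInr p) (gammaDotCχq p) where
  admα := modelχq_isAdmissibleEpsZ p
  admβ := modelχq_isAdmissibleEpsZ p
  Γ := conjEpsPMχq p
  preserves := preservesCoverings_conjEpsPMχq p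
  restricts := by
    refine ⟨epsPMχq p * ((MuTwoSetting.modelχq p 1 2 even_two).epsMu)⁻¹ * (epsPMχq p)⁻¹, fun x => ?_⟩
    have hγ : ((gammaDotCχq p).toMulEquiv x).1 =
        (MuTwoSetting.modelχq p 1 2 even_two).epsPM * (MuTwoSetting.modelχq p 1 2 even_two).epsMu * x.1 *
          ((MuTwoSetting.modelχq p 1 2 even_two).epsPM * (MuTwoSetting.modelχq p 1 2 even_two).epsMu)⁻¹ := rfl
    have hΓ : (conjEpsPMχq p).toMulEquiv x.1 = epsPMχq p * x.1 * (epsPMχq p)⁻¹ := rfl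
    rw [hγ, hΓ, ← epsPMχq_eq]
    simp only [mul_inv_rev, inv_inv, mul_assoc, inv_mul_cancel_left]
  γX := inversionχq p 1 2
  γX_spec x := (conjEpsPMχq_inl p x).symm
  thm16i := thm16i_inversionχq p 1 2 even_two
  companion := companionInvχq p
  maps_orbit y := by
    haveI := (ThetaSetting.modelχq p 1 2 even_two).compat.GtpYdd_normal
    have hT := transport_etaDdχq p 1 2 even_two (companionInvχq p)
    constructor
    · rintro ⟨σ, hσ, rfl⟩
      refine ⟨ContH1.conj (ThetaSetting.modelχq p 1 2 even_two).toTheta (ThetaSetting.modelχq p 1 2 even_two).DeltaTheta (inversionχq p 1 2 σ) (etaDdχq p 1 2 even_two),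
        ⟨inversionχq p 1 2 σ, (inl_inversionχq_mem_dotX_iff p σ).mpr hσ, rfl⟩, ?_⟩
      change ContH1.conj _ _ σ (etaDdχq p 1 2 even_two) =
        ThetaSetting.transport (companionInvχq p) (thm16i_inversionχq p 1 2 even_two)
          (ContH1.conj _ _ (inversionχq p 1 2 σ) (etaDdχq p 1 2 even_two))
      rw [ThetaSetting.transport_conj, hT]
      change _ = ContH1.conj _ _ (inversionχq p 1 2 (inversionχq p 1 2 σ)) (etaDdχq p 1 2 even_two)
      rw [inversionχq_inversionχq]
    · rintro ⟨_, ⟨σ, hσ, rfl⟩, rfl⟩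
      refine ⟨inversionχq p 1 2 σ, (inl_inversionχq_mem_dotX_iff p σ).mpr hσ, ?_⟩
      change ThetaSetting.transport (companionInvχq p) (thm16i_inversionχq p 1 2 even_two)
        (ContH1.conj _ _ σ (etaDdχq p 1 2 even_two)) = ContH1.conj _ _ (inversionχq p 1 2 σ) (etaDdχq p 1 2 even_two)
      rw [ThetaSetting.transport_conj, hT]
      rfl

/-- The extension `Γ` of the hypothesis is `conj ε_±`, and `γ_X = ι`. [cite: MochizukiEtTh2009, Prop 1.8 p.28] -/
theorem thm110HypothesisInvχq_Γ_γX :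
    (thm110HypothesisInvχq p).Γ = conjEpsPMχq p ∧ (thm110HypothesisInvχq p).γX = inversionχq p 1 2 := ⟨rfl, rfl⟩

/-! ### §3. The K2 binders at this hypothesis -/

/-- **«The isomorphism `K̈^× ⥲ K̈^×` induced by `γ`» is the IDENTITY**: `Thm110DeltaInduced H (refl)` at stage 2.
[cite: MochizukiEtTh2009, Thm 1.10 (ii) p.30] -/
theorem deltaInduced_invχq : Thm110DeltaInduced (thm110HypothesisInvχq p) (MulEquiv.refl _) := fun a => by
  change ThetaSetting.transport (companionInvχq p) (thm16i_inversionχq p 1 2 even_two)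
      ((ThetaSetting.modelχq p 1 2 even_two).inflTheta (ThetaSetting.modelχq p 1 2 even_two).GtpYdd ((kummerDataχqInr p).kumYdd ((kummerDataχqInr p).toKddHat a))) =
    (ThetaSetting.modelχq p 1 2 even_two).inflTheta (ThetaSetting.modelχq p 1 2 even_two).GtpYdd ((kummerDataχqInr p).kumYdd ((kummerDataχqInr p).toKddHat a))
  exact transport_inflTheta_kumYdd_ofSection p 1 2 even_two (companionInvχq p) _ _ _ _ _ _

/-- `Thm110DeltaCompat` for the identity (units, order and `±1` trivially preserved). [cite: MochizukiEtTh2009, Thm 1.10 (i) p.29] -/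
theorem deltaCompat_refl_invχq :
    Thm110DeltaCompat (Mα := MuTwoSetting.modelχq p 1 2 even_two) (Mβ := MuTwoSetting.modelχq p 1 2 even_two)
      (MulEquiv.refl (↥(MuTwoSetting.modelχq p 1 2 even_two).Kdd)ˣ) :=
  ⟨fun _ => Iff.rfl, fun _ _ => Iff.rfl, fun _ => Iff.rfl⟩

/-- The algebra of the r5 computation: from `k·k' = χ(c₀)/c₀`, `(k·k)⁻¹ = c₀²·k'²·χ(c₀²)⁻¹`. [folklore] -/
private theorem r5_algebra' {G : Type*} [CommGroup G] (χ : G →* G) {k k' c₀ : G} (hA : k * k' = χ c₀ * c₀⁻¹) :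
    (k * k)⁻¹ = c₀ * c₀ * (k' * k') * (χ (c₀ * c₀))⁻¹ := by
  have hk : k = χ c₀ * c₀⁻¹ * k'⁻¹ := eq_mul_inv_of_mul_eq hA
  rw [map_mul, hk]
  apply Additive.ofMul.injective
  simp only [ofMul_mul, ofMul_inv]
  abel

/-- **At the Tate pair the inversion defect vanishes on sections**: `(ι x).left = ι_Γ(x.left)` for every `x ∈ Π^tp_X` of
`modelχq p 1 2` (`d(σ) = κ_p(σ)^{−1−1+2} = 1`). [cite: MochizukiEtTh2009, §2 p.36] -/
theorem inversionχq_left_tate (x : PiTpχq p 1 2) : (inversionχq p 1 2 x).left = gfpInv x.left := by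
  rw [inversionχq_apply, tateInversion_left, invDefect_tatePairHom]
  have h0 : (-1 + -1 + 2 : ℤ) = 0 := by norm_num
  rw [h0, zpow_zero, map_one, mul_one]

/-- **`ι` carries the twisted section of `τ` to a `Π^tp_Ẍ`-conjugate of that of `τ⁻¹`** (stage 2, Tate pair): with `c₀`
the coboundary constant of `κ_{√−1}·κ_{(√−1)⁻¹}` (abc-iut-w5-d140), `ι(s_{√−1}(σ)) = b^{c₀²} · s_{(√−1)⁻¹}(σ) · b^{−c₀²}`.
[cite: MochizukiEtTh2009, Thm 1.10 (ii) p.30] -/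
theorem exists_inversionχq_sectionOfUnitχq_conj (hp : p % 4 = 1) :
    ∃ c₀ : ZH, ∀ σ : GQp p,
      inversionχq p 1 2 (sectionOfUnitχq p 1 2 even_two (sqrtNegOneUnitχ p hp) σ) =
        (SemidirectProduct.inl (bPowGfp (c₀ * c₀)) : PiTpχq p 1 2) *
          sectionOfUnitχq p 1 2 even_two (sqrtNegOneInvUnitχ p hp) σ * (SemidirectProduct.inl (bPowGfp (c₀ * c₀)))⁻¹ := by
  obtain ⟨c₀, hc₀⟩ := exists_coboundary_kappa_mul_kappaInv p hp
  refine ⟨c₀, fun σ => ?_⟩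
  refine SemidirectProduct.ext ?_ ?_
  · show (inversionχq p 1 2 (sectionχq p 1 2 _ (kappaUnitχq_sq_mul p 1 2 even_two (sqrtNegOneUnitχ p hp)) σ)).left =
      ((SemidirectProduct.inl (bPowGfp (c₀ * c₀)) : PiTpχq p 1 2) *
        sectionχq p 1 2 _ (kappaUnitχq_sq_mul p 1 2 even_two (sqrtNegOneInvUnitχ p hp)) σ *
          (SemidirectProduct.inl (bPowGfp (c₀ * c₀)))⁻¹).left
    rw [inversionχq_left_tate, sectionχq_left, gfpInv_bPowGfp, ← map_inv, inl_bPowGfp_conj_sectionχq_left,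
      Pi.mul_apply, Pi.mul_apply, kappaUnitχq_tate_eq, kappaUnitχq_tate_eq]
    congr 1
    letI : CommGroup ZH := { (inferInstance : Group ZH) with mul_comm := ZHatCompletion.mul_comm }
    exact r5_algebra' (chi p σ).toMonoidHom (hc₀ σ)
  · show (inversionχq p 1 2 (sectionχq p 1 2 _ (kappaUnitχq_sq_mul p 1 2 even_two (sqrtNegOneUnitχ p hp)) σ)).right =
      ((SemidirectProduct.inl (bPowGfp (c₀ * c₀)) : PiTpχq p 1 2) *
        sectionχq p 1 2 _ (kappaUnitχq_sq_mul p 1 2 even_two (sqrtNegOneInvUnitχ p hp)) σ *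
          (SemidirectProduct.inl (bPowGfp (c₀ * c₀)))⁻¹).right
    rw [inl_bPowGfp_conj_sectionχq_right, inversionχq_apply, tateInversion_right, sectionχq_right]

/-- `inclX (b^{t·t}) ∈ Π^tp_Ẋ` (it is the square `(inclX b^t)²`, and squares lie in `inclX(Π^tp_Ẍ)`).
[cite: MochizukiEtTh2009, Def 1.7 p.27] -/
theorem inl_inl_bPowGfp_mul_self_mem_dotX (t : ZH) :
    (SemidirectProduct.inl (SemidirectProduct.inl (bPowGfp (t * t)) : PiTpχq p 1 2) : PiTpCq p 1 2) ∈ (MuTwoSetting.modelχq p 1 2 even_two).dotX (epsZχq p) := by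
  refine Subgroup.mem_sup_left ?_
  rw [map_mul, map_mul, map_mul]
  exact (MuTwoSetting.modelχq p 1 2 even_two).sq_mem_GtpXdd _

/-- **The typed row r5 `Thm110DecompTransport H A A` HOLDS for `γ` at the stage-2 record, by the SECOND printed
alternative «`D_{τα} ↦` (a `Π^tp_Ẋ`-conjugate of) `D_{τβ⁻¹}`»** with conjugator `b^{c₀²} ∈ inclX(Π^tp_Ẍ) ≤ Π^tp_Ẋ`.
[cite: MochizukiEtTh2009, Thm 1.10 (ii) p.30] -/
theorem decompTransport_invχq (hp : p % 4 = 1) :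
    Thm110DecompTransport (thm110HypothesisInvχq p) (anchoredStandardDataχq p hp).toStandardData
      (anchoredStandardDataχq p hp).toStandardData := by
  obtain ⟨c₀, hc₀⟩ := exists_inversionχq_sectionOfUnitχq_conj p hp
  refine ⟨SemidirectProduct.inl (bPowGfp (c₀ * c₀)), inl_inl_bPowGfp_mul_self_mem_dotX p c₀, Or.inr ?_⟩
  change ((ThetaSetting.modelχq p 1 2 even_two).GKdd.map (sectionOfUnitχq p 1 2 even_two (sqrtNegOneUnitχ p hp))).map
      (inversionχq p 1 2).toMulEquiv.toMonoidHom =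
    ((ThetaSetting.modelχq p 1 2 even_two).GKdd.map (sectionOfUnitχq p 1 2 even_two (sqrtNegOneInvUnitχ p hp))).map
      (MulAut.conj (SemidirectProduct.inl (bPowGfp (c₀ * c₀)) : PiTpχq p 1 2)).toMonoidHom
  rw [Subgroup.map_map, Subgroup.map_map]
  congr 1
  exact MonoidHom.ext fun σ => hc₀ σ

/-! ### §4. Thm. 1.10 (i)(ii) for `γ` at the stage-2 record — every binder discharged -/

/-- **[EtTh] Thm. 1.10 (i) AND (ii) HOLD at `MuTwoSetting.modelχq p 1 2` for the NON-TRIVIAL `γ`** (inner by `ε_±ε_μ`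
on `Π^tp_Ċ`, `γ_X = ι`), `p ≡ 1 (mod 4)`, at the anchored Def. 1.9 datum and the class `η̈♯ = etaDdχq` — by the deck route
p430193 with ALL binders theorems: `Thm110DeltaInduced H id` (§3), `Thm110DeltaCompat id`, r5 (§3, second alternative),
the deck relation (part 0's `exists_deck_modelχq`) and `Prop15ii`. [cite: MochizukiEtTh2009, Thm 1.10 (ii) p.30] -/
theorem modelχq_thm110i_and_ii_invχq (hp : p % 4 = 1) :
    Thm110i (thm110HypothesisInvχq p) (anchoredStandardDataχq p hp).toStandardData
        (anchoredStandardDataχq p hp).toStandardData ∧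
      Thm110ii (thm110HypothesisInvχq p) (anchoredStandardDataχq p hp).toStandardData
        (anchoredStandardDataχq p hp).toStandardData := by
  obtain ⟨ε, hε, hD⟩ := exists_deck_modelχq p hp
  exact ⟨thm110i_of_decompTransport_of_deck (thm110HypothesisInvχq p) _ _ (prop15ii_etaleThetaDataχqInr p _)
      (prop15ii_etaleThetaDataχqInr p _) (MulEquiv.refl _) (deltaInduced_invχq p) (deltaCompat_refl_invχq p)
      (decompTransport_invχq p hp) hε hD hε hD,
    thm110ii_of_decompTransport_of_deck (thm110HypothesisInvχq p) _ _ (prop15ii_etaleThetaDataχqInr p _)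
      (prop15ii_etaleThetaDataχqInr p _) (MulEquiv.refl _) (deltaInduced_invχq p)
      (decompTransport_invχq p hp) hε hD hε hD⟩

/-- **CENSUS HEADLINE — the K2 pipeline at a non-identity isomorphism, with Prop. 1.5 (iii).** For `p ≡ 1 (mod 4)` there
are a Def. 1.7 setting `M` (guards `IsEtThOrigin` AND `IsTateOrigin`, admissible `ε_Z`), an étale-theta datum `E` satisfying
the typed Prop. 1.5 (i), (ii) AND (iii), an ANCHORED standard datum `A` with the deck relation, and an isomorphism
`γ : Π^tp_Ċ ⥲ Π^tp_Ċ` which is NOT the identity (`γ_X` a non-trivial involution of `Π^tp_X`) with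
`H : Thm110Hypothesis ε_Z ε_Z hC hC E E γ`, such that `Thm110i H A A ∧ Thm110ii H A A ∧ Thm110iUnique hC hZ E A`.
[cite: MochizukiEtTh2009, Thm 1.10 p.29] -/
theorem _root_.Literature.AnabelianGeometry.EtaleTheta.MuTwoSetting.exists_stage2_model_thm110_nontrivial_iso_with_prop15iii
    (hp : p % 4 = 1) :
    ∃ (M : MuTwoSetting p) (εZ : M.GtpC) (hZ : M.IsAdmissibleEpsZ εZ) (E : M.toThetaSetting.EtaleThetaData)
      (A : M.AnchoredStandardData E.toKummerData) (γ : ↥(M.dotC εZ) ≃ₜ* ↥(M.dotC εZ))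
      (H : Thm110Hypothesis εZ εZ M.toThetaSetting.compat M.toThetaSetting.compat E E γ),
      M.toThetaSetting.IsEtThOrigin ∧ M.toThetaSetting.IsTateOrigin ∧
      γ ≠ ContinuousMulEquiv.refl _ ∧ H.γX ≠ ContinuousMulEquiv.refl _ ∧ (∀ x, H.γX (H.γX x) = x) ∧
      ThetaSetting.Prop15i E.toKummerData M.toThetaSetting.compat ∧
      ThetaSetting.Prop15ii E.toKummerData M.toThetaSetting.compat ∧
      ThetaSetting.Prop15iii E M.toThetaSetting.compat ∧
      (∃ ε : M.PiTemp, M.toZ ε = 1 ∧ A.tauInv.Dpt = A.tau.Dpt.comap (MulAut.conj ε).toMonoidHom) ∧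
      Thm110i H A.toStandardData A.toStandardData ∧ Thm110ii H A.toStandardData A.toStandardData ∧
      Thm110iUnique M.toThetaSetting.compat hZ E A.toStandardData := by
  obtain ⟨h1, h2⟩ := modelχq_thm110i_and_ii_invχq p hp
  refine ⟨MuTwoSetting.modelχq p 1 2 even_two, epsZχq p, modelχq_isAdmissibleEpsZ p, etaleThetaDataχqInr p,
    anchoredStandardDataχq p hp, gammaDotCχq p, thm110HypothesisInvχq p, ThetaSetting.modelχq_isEtThOrigin p 1 2 even_two,
    modelχq_isTateOrigin p 1, gammaDotCχq_ne_refl p, ?_, fun x => inversionχq_inversionχq p 1 2 x,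
    (prop15i_and_ii_kummerDataχqInr p _).1, prop15ii_etaleThetaDataχqInr p _, prop15iii_etaleThetaDataχqInr p _,
    exists_deck_modelχq p hp, h1, h2, modelχq_thm110iUnique p hp⟩
  intro h
  apply inversionχq_ne_refl p 1 2
  exact congrArg ContinuousMulEquiv.toMulEquiv h

end Literature.AnabelianGeometry.EtaleTheta.SettingModel

end
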